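import Literature.NumberTheory.Sieve.PolynomialCongruencesMeanValues
import Literature.NumberTheory.Sieve.PolynomialCongruencesLemmas
import Literature.NumberTheory.LFunctions.BatemanHornSystemEulerProduct

/-!
# SoloInformedSquarefreeSysRootCountSum — `∑_{m ≤ y} μ²(m) ρ_f(m) ≪ y (log y)^{k-1}` for a Bateman–Horn system

Solo unit `solo-Parity-informed` (ideation tier, informed mode), session 17; `PLAN.md` §25.2, CLAIMS C77.

For a Bateman–Horn system `f : ι → ℤ[X]` (`k = card ι`, `ρ_f = polyRootCountMod f`, the root count of the
product `F = ∏ fᵢ`), the squarefree-supported root count `m ↦ μ²(m) ρ_f(m)` is multiplicative, vanishes at the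
proper prime powers and is `≤ D = ∑ deg fᵢ` at the primes, while `∑_{p ≤ x} ρ_f(p)/p ≤ k log log x + C`
(`ρ_f(p) ≤ ∑ᵢ ρ_{fᵢ}(p)` and the tree's Mertens bound for each irreducible `fᵢ`).  Hall–Tenenbaum's Theorem 01
with (0.4) (the tree's `HallTenenbaum.sum_le_of_le`) then gives

* `exists_sum_primesLE_sysRootCount_div_le` — `∑_{p ≤ x} ρ_f(p)/p ≤ k · log log x + C` (`x ≥ 2`);
* `exists_sum_abs_moebius_mul_sysRootCount_le` — `∑_{m ≤ y} |μ(m)| ρ_f(m) ≤ C (y / log y) (log y)^k` (`y ≥ 2`).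

This is the first-moment input for the small-divisor remainder in the `k`-dimensional large-divisor
localisation of Bateman–Horn (`SoloInformedLargeDivisorsSystem`).  (The full `ρ_f` has unbounded prime-power
values for a reducible product, so the restriction to squarefree `m` — all that the Möbius sums see — matters.)
-/

namespace Summit.Parity.BatemanHorn.Theorems

open Finset ArithmeticFunction Polynomial
open scoped ArithmeticFunction.Moebius
open Literature.NumberTheory.Sieve (polyRootCountMod IsBatemanHornSystem exists_sum_primesLE_rootCount_div_le)
open Literature.NumberTheory.LFunctions (polyRootCountModSys_mul_of_coprime polyRootCountModSys_le_sum_single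
  sys_rootCount_le)

variable {ι : Type*} [Fintype ι]

/-- **Mertens for a system**: `∑_{p ≤ x} ρ_f(p)/p ≤ k · log log x + C` for `x ≥ 2` (`k = card ι`). -/
theorem exists_sum_primesLE_sysRootCount_div_le {f : ι → ℤ[X]} (hf : IsBatemanHornSystem f) :
    ∃ C : ℝ, 0 ≤ C ∧ ∀ x : ℕ, 2 ≤ x →
      ∑ p ∈ Nat.primesLE x, (polyRootCountMod f p : ℝ) / p ≤ Fintype.card ι * Real.log (Real.log x) + C := by
  classical
  choose C hC using fun i => exists_sum_primesLE_rootCount_div_le (hf.irreducible i) (hf.natDegree_pos i)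
  refine ⟨∑ i, |C i|, sum_nonneg fun i _ => abs_nonneg _, fun x hx => ?_⟩
  calc ∑ p ∈ Nat.primesLE x, (polyRootCountMod f p : ℝ) / p
      ≤ ∑ p ∈ Nat.primesLE x, ∑ i, (polyRootCountMod ![f i] p : ℝ) / p := by
        refine sum_le_sum fun p hp => ?_
        rw [← sum_div]
        exact div_le_div_of_nonneg_right
          (by exact_mod_cast polyRootCountModSys_le_sum_single f (Nat.prime_of_mem_primesLE hp))
          (Nat.cast_nonneg _)
    _ = ∑ i, ∑ p ∈ Nat.primesLE x, (polyRootCountMod ![f i] p : ℝ) / p := sum_comm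
    _ ≤ ∑ i, (Real.log (Real.log x) + |C i|) :=
        sum_le_sum fun i _ => (hC i x hx).trans (by linarith [le_abs_self (C i)])
    _ = Fintype.card ι * Real.log (Real.log x) + ∑ i, |C i| := by
        rw [sum_add_distrib, sum_const, card_univ, nsmul_eq_mul]

/-- `ρ_f(1) = 1` for any family. -/
theorem polyRootCountMod_sys_one (f : ι → ℤ[X]) : polyRootCountMod f 1 = 1 := by
  simp [polyRootCountMod]

/-- **`∑_{m ≤ y} |μ(m)| ρ_f(m) ≤ C · (y / log y) · (log y)^k`** for a Bateman–Horn system `f` (`k = card ι`) and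
`y ≥ 2` — Hall–Tenenbaum's Theorem 01 with (0.4) for the multiplicative function `|μ| ρ_f`. -/
theorem exists_sum_abs_moebius_mul_sysRootCount_le {f : ι → ℤ[X]} (hf : IsBatemanHornSystem f) :
    ∃ C : ℝ, 0 < C ∧ ∀ y : ℝ, 2 ≤ y →
      ∑ m ∈ Icc 1 ⌊y⌋₊, |(μ m : ℝ)| * (polyRootCountMod f m : ℝ)
        ≤ C * (y / Real.log y) * Real.log y ^ Fintype.card ι := by
  classical
  obtain ⟨Cf, hCf0, hCf⟩ := exists_sum_primesLE_sysRootCount_div_le hf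
  set k : ℕ := Fintype.card ι with hk
  set D : ℕ := ∑ i, (f i).natDegree with hD
  set K : ℝ := (D : ℝ) + 1 with hK
  have hK1 : (1 : ℝ) ≤ K := by rw [hK]; linarith [(Nat.cast_nonneg D : (0 : ℝ) ≤ D)]
  set C₁ : ℝ := K * Real.log 4 + K * Literature.NumberTheory.LFunctions.HallTenenbaum.B₁ + 1 with hC₁
  have hC₁0 : 0 < C₁ := by
    have := Literature.NumberTheory.LFunctions.HallTenenbaum.B₁_nonneg
    have : 0 ≤ Real.log 4 := Real.log_nonneg (by norm_num)
    positivity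
  refine ⟨C₁ * Real.exp (K + Cf), by positivity, fun y hy => ?_⟩
  have hy1 : 1 < y := by linarith
  set ρ : ℕ → ℝ := fun m => |(μ m : ℝ)| * (polyRootCountMod f m : ℝ) with hρ
  have hρ1 : ρ 1 = 1 := by simp [hρ, polyRootCountMod_sys_one]
  have hρ0 : ∀ m, 0 ≤ ρ m := fun m => mul_nonneg (abs_nonneg _) (Nat.cast_nonneg _)
  have hρmul : ∀ a b, Nat.Coprime a b → ρ (a * b) = ρ a * ρ b := fun a b hab => by
    simp only [hρ, polyRootCountModSys_mul_of_coprime f hab, Nat.cast_mul,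
      ArithmeticFunction.isMultiplicative_moebius.map_mul_of_coprime hab, Int.cast_mul, abs_mul]
    ring
  have hρK : ∀ p : ℕ, p.Prime → ∀ ν : ℕ, 1 ≤ ν → ρ (p ^ ν) ≤ K := by
    intro p hp ν hν
    rcases eq_or_lt_of_le hν with h1 | h2
    · rw [← h1, pow_one]
      simp only [hρ]
      have hμ : |(μ p : ℝ)| ≤ 1 := by exact_mod_cast abs_moebius_le_one
      have hρp : (polyRootCountMod f p : ℝ) ≤ D := by rw [hD]; exact sys_rootCount_le hf hp
      calc |(μ p : ℝ)| * (polyRootCountMod f p : ℝ) ≤ 1 * D :=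
            mul_le_mul hμ hρp (Nat.cast_nonneg _) zero_le_one
        _ ≤ K := by rw [hK]; linarith
    · have hsq : ¬ Squarefree (p ^ ν) := by
        rw [Nat.squarefree_pow_iff hp.ne_one (by omega)]
        rintro ⟨-, hν1⟩
        omega
      simp only [hρ, ArithmeticFunction.moebius_eq_zero_of_not_squarefree hsq, Int.cast_zero, abs_zero,
        zero_mul]
      linarith
  have hHT := Literature.NumberTheory.Sieve.HallTenenbaum.sum_le_of_le hρ1 hρmul hρ0 hK1 hρK hy1
  have hfl2 : 2 ≤ ⌊y⌋₊ := Nat.le_floor (by simpa using hy)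
  have hlogy : 0 < Real.log y := Real.log_pos hy1
  have hprime : ∑ p ∈ Nat.primesLE ⌊y⌋₊, ρ p / p ≤ k * Real.log (Real.log y) + Cf := by
    have h0 : ∑ p ∈ Nat.primesLE ⌊y⌋₊, ρ p / p ≤ ∑ p ∈ Nat.primesLE ⌊y⌋₊, (polyRootCountMod f p : ℝ) / p := by
      refine sum_le_sum fun p _ => div_le_div_of_nonneg_right ?_ (Nat.cast_nonneg _)
      have hμ : |(μ p : ℝ)| ≤ 1 := by exact_mod_cast abs_moebius_le_one
      calc ρ p = |(μ p : ℝ)| * (polyRootCountMod f p : ℝ) := rfl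
        _ ≤ 1 * (polyRootCountMod f p : ℝ) := mul_le_mul_of_nonneg_right hμ (Nat.cast_nonneg _)
        _ = _ := one_mul _
    refine h0.trans ((hCf ⌊y⌋₊ hfl2).trans ?_)
    have h1 : (2 : ℝ) ≤ ⌊y⌋₊ := by exact_mod_cast hfl2
    have h2 : (⌊y⌋₊ : ℝ) ≤ y := Nat.floor_le (by linarith)
    have h3 := Real.log_le_log (Real.log_pos (by linarith)) (Real.log_le_log (by linarith) h2)
    have hk0 : (0 : ℝ) ≤ k := Nat.cast_nonneg _
    nlinarith
  have hexp : Real.exp (K + ∑ p ∈ Nat.primesLE ⌊y⌋₊, ρ p / p)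
      ≤ Real.exp (K + Cf) * Real.log y ^ k := by
    calc Real.exp (K + ∑ p ∈ Nat.primesLE ⌊y⌋₊, ρ p / p)
        ≤ Real.exp (K + Cf + k * Real.log (Real.log y)) := Real.exp_le_exp.2 (by linarith)
      _ = Real.exp (K + Cf) * Real.log y ^ k := by
          rw [Real.exp_add, ← Real.log_rpow hlogy, Real.exp_log (Real.rpow_pos_of_pos hlogy _),
            Real.rpow_natCast]
  calc ∑ m ∈ Icc 1 ⌊y⌋₊, ρ m
      ≤ C₁ * (y / Real.log y) * Real.exp (K + ∑ p ∈ Nat.primesLE ⌊y⌋₊, ρ p / p) := hHT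
    _ ≤ C₁ * (y / Real.log y) * (Real.exp (K + Cf) * Real.log y ^ k) :=
        mul_le_mul_of_nonneg_left hexp (by positivity)
    _ = C₁ * Real.exp (K + Cf) * (y / Real.log y) * Real.log y ^ k := by ring

/-- The handier consequence for `k ≥ 1`: `∑_{m ≤ y} |μ(m)| ρ_f(m) ≤ C · y · (log y)^{k-1}` (`y ≥ 2`). -/
theorem exists_sum_abs_moebius_mul_sysRootCount_le' {f : ι → ℤ[X]} (hf : IsBatemanHornSystem f)
    (hk : 0 < Fintype.card ι) :
    ∃ C : ℝ, 0 < C ∧ ∀ y : ℝ, 2 ≤ y →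
      ∑ m ∈ Icc 1 ⌊y⌋₊, |(μ m : ℝ)| * (polyRootCountMod f m : ℝ)
        ≤ C * y * Real.log y ^ (Fintype.card ι - 1) := by
  obtain ⟨C, hC0, hC⟩ := exists_sum_abs_moebius_mul_sysRootCount_le hf
  refine ⟨C, hC0, fun y hy => (hC y hy).trans_eq ?_⟩
  have hlogy : 0 < Real.log y := Real.log_pos (by linarith)
  obtain ⟨j, hj⟩ := Nat.exists_eq_succ_of_ne_zero hk.ne'
  rw [hj, Nat.succ_sub_one, pow_succ]
  field_simp

end Summit.Parity.BatemanHorn.Theorems
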